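import Literature.Analysis.FluidPDE.OnsagerBDSVSchauderHigher
import HarnessLib

/-!
# The BDSV gluing stage: `ℛ ∘ curl` as a zero-order operator and its commutator (proofs)

Sequel to `OnsagerBDSVPotentialTheory.lean` (the named facts `BDSV.holderCZBound` = App. C
Prop. C.1 and `BDSV.commutatorCZBound` = App. D Prop. D.1 of Buckmaster–De Lellis–Székelyhidi–Vicol
2019 for the second Riesz transforms `∂ᵢ∂ⱼΔ⁻¹` of `T³`, and the identity
`BDSV.antidivergence_curl`) and to `OnsagerBDSVSchauderHigher.lean` (Prop. C.1 at all orders and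
for vector fields, `BDSV.holderCZBound.rieszHessian_vec_le`). In the proof of Prop. 4.3 (§4.4) the
two facts are applied to the operator `ℛ ∘ curl` acting on the vector potentials `zᵢ - zᵢ₊₁`:
"Note that `ℛ curl` is a zero-order operator. Therefore … `‖R̊̄_q‖_{N+α} ≲ τ_q⁻¹‖zᵢ - zᵢ₊₁‖_{N+α} + …`"
and "`∂ₜχᵢ [v·∇, ℛ curl](zᵢ - zᵢ₊₁)` … using Proposition D.1". This file PROVES both passages:

* `BDSV.rieszTensor z x = (∂ₐ∂ᵢΔ⁻¹ z (x))_{a,i}` and the fixed linear map `BDSV.curlAssembly` with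
  `ℛ(curl z)(x) = curlAssembly (rieszTensor z x)` (`BDSV.antidivergence_curl_eq_curlAssembly`):
  `ℛ ∘ curl` is a fixed linear recombination of second Riesz transforms of the components;
* `BDSV.holderCZBound.antidivergence_curl_le` — **"`ℛ curl` is a zero-order operator"**:
  `‖ℛ(curl z)‖_{N,α} ≤ C‖z‖_{N,α}` for smooth `z : T³ → ℝ³` (matrix fields normed with the sup
  over columns, as the stresses of `BDSV.HolderSupLE`);
* `BDSV.commutatorCZBound.antidivergence_curl_le` — **the commutator estimate for `ℛ ∘ curl`**:
  `‖(b·∇)ℛ(curl z) - ℛ(curl (b·∇)z)‖_{N,α} ≤ C(‖b‖_{1,α}‖z‖_{N,α} + ‖b‖_{N+1,α}‖z‖_{0,α})`, through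
  `BDSV.commutatorTensor` (the entries of `(b·∇) rieszTensor z - rieszTensor((b·∇)z)` are the
  scalar commutators of `BDSV.commutatorCZBound`, `BDSV.commutatorTensor_apply`);
* supporting lemmas: fields with values in finite products (`Torus.eContDiffHolderNorm_pi_le_sum`),
  `(b·∇)(L ∘ f) = L ∘ (b·∇)f` (`BDSV.convect_clm_comp`).

## References

* T. Buckmaster, C. De Lellis, L. Székelyhidi Jr., V. Vicol, *Onsager's conjecture for admissible
  weak solutions*, Comm. Pure Appl. Math. 72 (2019) 229–274 = arXiv:1701.08678, §4.4 (proof of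
  Prop. 4.3), App. C Prop. C.1, App. D Prop. D.1.
-/

noncomputable section

open MeasureTheory Set Filter Function
open scoped ContDiff NNReal ENNReal


namespace Literature.Analysis.FluidPDE

namespace BDSV

open FunctionSpaces FunctionSpaces.Torus

/-- The flat three-torus `T³ = (ℝ/ℤ)³`, local notation. -/
local notation "𝕋³" => UnitAddTorus (Fin 3)

/-- Euclidean `ℝ³`, local notation. -/
local notation "ℝ³" => EuclideanSpace ℝ (Fin 3)


/-! ## Pi-valued fields: norms of the components control the norm -/

section PiValued

variable {d : Type*} [Fintype d] {κ : Type*} [Fintype κ] [DecidableEq κ] {Φ : κ → Type*}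
  [∀ k, NormedAddCommGroup (Φ k)] [∀ k, NormedSpace ℝ (Φ k)]

/-- `‖y ↦ (0,…,y,…,0)‖ ≤ 1` for the coordinate embeddings of a finite product. [folklore] -/
theorem _root_.Literature.Analysis.FunctionSpaces.Torus.enorm_clmSingle_le_one (k : κ) :
    ‖(ContinuousLinearMap.single ℝ Φ k : Φ k →L[ℝ] (∀ k, Φ k))‖ₑ ≤ 1 := by
  rw [← ofReal_norm, ← ENNReal.ofReal_one]
  refine ENNReal.ofReal_le_ofReal (ContinuousLinearMap.opNorm_le_bound _ zero_le_one fun y => ?_)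
  have e : (ContinuousLinearMap.single ℝ Φ k : Φ k →L[ℝ] (∀ k, Φ k)) y = Pi.single k y := rfl
  rw [one_mul, e, Pi.norm_single]

/-- The `C^{N,r}` norm of a field with values in a finite product is at most the sum of the norms
of its components. [folklore] -/
theorem _root_.Literature.Analysis.FunctionSpaces.Torus.eContDiffHolderNorm_pi_le_sum {N : ℕ}
    {G : UnitAddTorus d → ∀ k, Φ k} (hG : IsContDiff N G) (r : ℝ≥0) :
    Torus.eContDiffHolderNorm N r G ≤ ∑ k, Torus.eContDiffHolderNorm N r (fun x => G x k) := by
  have hGk : ∀ k, IsContDiff N (fun x => G x k) := fun k =>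
    (ContinuousLinearMap.proj k : (∀ k, Φ k) →L[ℝ] Φ k).contDiff.comp hG
  have e : G = ∑ k, fun x => (ContinuousLinearMap.single ℝ Φ k : Φ k →L[ℝ] (∀ k, Φ k)) (G x k) := by
    funext x
    rw [Finset.sum_apply]
    exact (Finset.univ_sum_single (G x)).symm
  conv_lhs => rw [e]
  refine (Torus.eContDiffHolderNorm_sum_le _ fun k _ => ?_).trans (Finset.sum_le_sum fun k _ => ?_)
  · exact ((ContinuousLinearMap.single ℝ Φ k).contDiff.comp (hGk k) :
      IsContDiff N (fun x => (ContinuousLinearMap.single ℝ Φ k : Φ k →L[ℝ] (∀ k, Φ k)) (G x k)))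
  · calc Torus.eContDiffHolderNorm N r (fun x => (ContinuousLinearMap.single ℝ Φ k : Φ k →L[ℝ] (∀ k, Φ k)) (G x k))
        ≤ ‖(ContinuousLinearMap.single ℝ Φ k : Φ k →L[ℝ] (∀ k, Φ k))‖ₑ *
            Torus.eContDiffHolderNorm N r (fun x => G x k) := Torus.eContDiffHolderNorm_clm_comp_le _ (hGk k) r
      _ ≤ 1 * Torus.eContDiffHolderNorm N r (fun x => G x k) := mul_le_mul' (enorm_clmSingle_le_one k) le_rfl
      _ = _ := one_mul _

end PiValued

/-! ## `ℛ ∘ curl` as a fixed linear recombination of second Riesz transforms -/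

section CurlAssembly

/-- The **Riesz–Hessian tensor** of a vector field: `(rieszTensor z x) a i = ∂ₐ∂ᵢΔ⁻¹ z (x) ∈ ℝ³`. [folklore] -/
def rieszTensor (z : 𝕋³ → ℝ³) (x : 𝕋³) : Fin 3 → Fin 3 → ℝ³ :=
  fun a i => rieszHessian a i z x

/-- `curlMatrix` of a pointwise sum (its additivity, in lambda form). [folklore] -/
theorem curlMatrix_add_fun (f g : Fin 3 → Fin 3 → ℝ) :
    curlMatrix (fun a b => f a b + g a b) = curlMatrix f + curlMatrix g :=
  map_add curlMatrix f g

/-- `curlMatrix` of a pointwise multiple (its homogeneity, in lambda form). [folklore] -/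
theorem curlMatrix_const_mul_fun (c : ℝ) (f : Fin 3 → Fin 3 → ℝ) :
    curlMatrix (fun a b => c * f a b) = c • curlMatrix f :=
  map_smul curlMatrix c f

/-- The fixed linear map recombining the Riesz–Hessian tensor into `ℛ(curl z)`:
`(𝓛M)ⱼ has i-th component curlMatrix(M · i ·)ⱼ + curlMatrix(M · j ·)ᵢ` (so that, with
`M = rieszTensor z x`, the two terms are `(curl ∂ᵢΔ⁻¹z)ⱼ` and `(curl ∂ⱼΔ⁻¹z)ᵢ`,
`BDSV.antidivergence_curl`). [folklore] -/
def curlAssemblyLin : (Fin 3 → Fin 3 → ℝ³) →ₗ[ℝ] (Fin 3 → ℝ³) where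
  toFun M := fun j => WithLp.toLp 2 fun i =>
    curlMatrix (fun a b => M a i b) j + curlMatrix (fun a b => M a j b) i
  map_add' M M' := by
    funext j
    ext i
    simp only [Pi.add_apply, PiLp.add_apply, curlMatrix_add_fun]
    ring
  map_smul' c M := by
    funext j
    ext i
    simp only [Pi.smul_apply, PiLp.smul_apply, smul_eq_mul, curlMatrix_const_mul_fun, RingHom.id_apply]
    ring

/-- `BDSV.curlAssemblyLin` as a continuous linear map. [folklore] -/
def curlAssembly : (Fin 3 → Fin 3 → ℝ³) →L[ℝ] (Fin 3 → ℝ³) :=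
  LinearMap.toContinuousLinearMap curlAssemblyLin

/-- Entries of `BDSV.curlAssembly`. [folklore] -/
theorem curlAssembly_apply (M : Fin 3 → Fin 3 → ℝ³) (j i : Fin 3) :
    curlAssembly M j i = curlMatrix (fun a b => M a i b) j + curlMatrix (fun a b => M a j b) i := rfl

variable {z : 𝕋³ → ℝ³}

/-- `curl ∂ᵢΔ⁻¹z (x) = curlMatrix ((∂ₐ∂ᵢΔ⁻¹z(x))_b)_{a,b}` (definitional). [folklore] -/
theorem curl_partialDeriv_invLaplacian_eq (z : 𝕋³ → ℝ³) (i : Fin 3) (x : 𝕋³) :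
    curl (partialDeriv i (invLaplacian z)) x = curlMatrix (fun a b => rieszTensor z x a i b) := rfl

/-- **`ℛ(curl z) = 𝓛(rieszTensor z)`** pointwise, for smooth `z` (`BDSV.antidivergence_curl`):
the operator `ℛ ∘ curl` is a fixed linear recombination of the second Riesz transforms of the
components of `z`. [cite: BuckmasterEtAl2018, §4.4 (proof of Prop. 4.3)] -/
theorem antidivergence_curl_eq_curlAssembly (hz : IsSmooth z) (x : 𝕋³) :
    Torus.antidivergence (curl z) x = curlAssembly (rieszTensor z x) := by
  funext j
  ext i
  rw [antidivergence_curl hz x i j, curlAssembly_apply, ← curl_partialDeriv_invLaplacian_eq z i x,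
    ← curl_partialDeriv_invLaplacian_eq z j x]

/-- The Riesz–Hessian tensor of a smooth field is smooth. [folklore] -/
theorem isSmooth_rieszTensor (hz : IsSmooth z) : IsSmooth (rieszTensor z) := by
  unfold IsSmooth
  refine contDiff_pi.2 fun a => contDiff_pi.2 fun i => ?_
  exact isSmooth_rieszHessian hz a i

/-- **"`ℛ curl` is a zero-order operator"** (BDSV §4.4, proof of Prop. 4.3, with App. C
Prop. C.1): `‖ℛ(curl z)‖_{N,α} ≤ C‖z‖_{N,α}` for smooth `z : T³ → ℝ³`, `0 < α < 1`, every `N`, if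
`BDSV.holderCZBound` holds; the matrix field `x ↦ ℛ(curl z)(x)` is normed with the sup over columns
(`Fin 3 → ℝ³`), as in `BDSV.HolderSupLE` for stresses. [cite: BuckmasterEtAl2018, §4.4 (proof of Prop. 4.3)] -/
theorem holderCZBound.antidivergence_curl_le (h : holderCZBound) {α : ℝ≥0} (hα0 : 0 < α) (hα1 : α < 1)
    (N : ℕ) : ∃ C : ℝ≥0∞, C ≠ ⊤ ∧ ∀ z : 𝕋³ → ℝ³, IsSmooth z →
      Torus.eContDiffHolderNorm N α (fun x => Torus.antidivergence (curl z) x) ≤ C * Torus.eContDiffHolderNorm N α z := by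
  obtain ⟨C, hC⟩ := h.rieszHessian_vec_le hα0 hα1 N
  refine ⟨‖curlAssembly‖ₑ * (9 * C), ENNReal.mul_ne_top enorm_ne_top (by exact_mod_cast ENNReal.coe_ne_top), fun z hz => ?_⟩
  have hHs : IsSmooth (rieszTensor z) := isSmooth_rieszTensor hz
  have hHN : IsContDiff N (rieszTensor z) := hHs.isContDiff (by exact_mod_cast le_top)
  have hHNa : ∀ a, IsContDiff N (fun x => rieszTensor z x a) := fun a =>
    (ContinuousLinearMap.proj a : (Fin 3 → Fin 3 → ℝ³) →L[ℝ] (Fin 3 → ℝ³)).contDiff.comp hHN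
  have e : (fun x => Torus.antidivergence (curl z) x) = fun x => curlAssembly (rieszTensor z x) :=
    funext (antidivergence_curl_eq_curlAssembly hz)
  have hH : Torus.eContDiffHolderNorm N α (rieszTensor z) ≤ 9 * C * Torus.eContDiffHolderNorm N α z := by
    calc Torus.eContDiffHolderNorm N α (rieszTensor z)
        ≤ ∑ a, Torus.eContDiffHolderNorm N α (fun x => rieszTensor z x a) := eContDiffHolderNorm_pi_le_sum hHN α
      _ ≤ ∑ a, ∑ i, Torus.eContDiffHolderNorm N α (fun x => rieszTensor z x a i) :=
          Finset.sum_le_sum fun a _ => eContDiffHolderNorm_pi_le_sum (hHNa a) α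
      _ ≤ ∑ _a : Fin 3, ∑ _i : Fin 3, (C : ℝ≥0∞) * Torus.eContDiffHolderNorm N α z :=
          Finset.sum_le_sum fun a _ => Finset.sum_le_sum fun i _ => hC a i z hz
      _ = 3 * (3 * (C * Torus.eContDiffHolderNorm N α z)) := by
          simp only [Finset.sum_const, Finset.card_univ, Fintype.card_fin, nsmul_eq_mul, Nat.cast_ofNat]
      _ = 9 * C * Torus.eContDiffHolderNorm N α z := by ring
  rw [e]
  calc Torus.eContDiffHolderNorm N α (fun x => curlAssembly (rieszTensor z x))
      ≤ ‖curlAssembly‖ₑ * Torus.eContDiffHolderNorm N α (rieszTensor z) := Torus.eContDiffHolderNorm_clm_comp_le _ hHN α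
    _ ≤ ‖curlAssembly‖ₑ * (9 * C * Torus.eContDiffHolderNorm N α z) := mul_le_mul' le_rfl hH
    _ = ‖curlAssembly‖ₑ * (9 * C) * Torus.eContDiffHolderNorm N α z := by ring

end CurlAssembly

/-! ## The commutator `[b·∇, ℛ curl]` -/

section Commutator

variable {F G : Type*} [NormedAddCommGroup F] [NormedSpace ℝ F] [NormedAddCommGroup G] [NormedSpace ℝ G]

/-- The convective derivative commutes with post-composition by a continuous linear map:
`(b·∇)(L ∘ f) = L ∘ (b·∇)f` for smooth `f`. [folklore] -/
theorem convect_clm_comp {f : 𝕋³ → F} (hf : IsSmooth f) (L : F →L[ℝ] G) (b : 𝕋³ → ℝ³) (x : 𝕋³) :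
    Torus.convect b (fun y => L (f y)) x = L (Torus.convect b f x) := by
  have hLf : IsContDiff 1 (fun y => L (f y)) := L.contDiff.comp (hf.isContDiff (by simp))
  rw [convect_eq_sum_smul_partialDeriv hLf, convect_eq_sum_smul_partialDeriv (hf.isContDiff (by simp)),
    map_sum]
  refine Finset.sum_congr rfl fun i _ => ?_
  rw [map_smul, show (fun y => L (f y)) = L ∘ f from rfl, partialDeriv_clm_comp hf L i x]

/-- Components of the convective derivative of a vector field: `((b·∇)z)_c = (b·∇)z_c`. [folklore] -/
theorem convect_apply_coord {z : 𝕋³ → ℝ³} (hz : IsSmooth z) (b : 𝕋³ → ℝ³) (x : 𝕋³) (c : Fin 3) :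
    Torus.convect b z x c = Torus.convect b (fun y => z y c) x := by
  have h := convect_clm_comp hz (EuclideanSpace.proj c : ℝ³ →L[ℝ] ℝ) b x
  exact h.symm

variable {b z : 𝕋³ → ℝ³}

/-- The commutator field `E = (b·∇)(rieszTensor z) - rieszTensor((b·∇)z)`, whose recombination
by `BDSV.curlAssembly` is `[b·∇, ℛ curl] z`. [folklore] -/
def commutatorTensor (b z : 𝕋³ → ℝ³) (x : 𝕋³) : Fin 3 → Fin 3 → ℝ³ :=
  Torus.convect b (rieszTensor z) x - rieszTensor (Torus.convect b z) x

/-- **`[b·∇, ℛ curl] z = 𝓛 ∘ commutatorTensor`**: for smooth `b, z`,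
`(b·∇)ℛ(curl z) - ℛ(curl (b·∇)z) = curlAssembly ∘ ((b·∇)rieszTensor z - rieszTensor((b·∇)z))`. [folklore] -/
theorem convect_antidivergence_curl_sub (hb : IsSmooth b) (hz : IsSmooth z) (x : 𝕋³) :
    Torus.convect b (fun y => Torus.antidivergence (curl z) y) x -
        Torus.antidivergence (curl (Torus.convect b z)) x = curlAssembly (commutatorTensor b z x) := by
  have e1 : (fun y => Torus.antidivergence (curl z) y) = fun y => curlAssembly (rieszTensor z y) :=
    funext (antidivergence_curl_eq_curlAssembly hz)
  rw [e1, convect_clm_comp (isSmooth_rieszTensor hz) curlAssembly b x,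
    antidivergence_curl_eq_curlAssembly (hb.convect hz) x, commutatorTensor, map_sub]

/-- The entries of the commutator tensor are the scalar commutators of `BDSV.commutatorCZBound`:
`(commutatorTensor b z x a i)_c = (b·∇)(∂ₐ∂ᵢΔ⁻¹ z_c)(x) - ∂ₐ∂ᵢΔ⁻¹((b·∇) z_c)(x)`. [folklore] -/
theorem commutatorTensor_apply (hb : IsSmooth b) (hz : IsSmooth z) (x : 𝕋³) (a i c : Fin 3) :
    commutatorTensor b z x a i c =
      Torus.convect b (rieszHessian a i (fun y => z y c)) x - rieszHessian a i (Torus.convect b (fun y => z y c)) x := by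
  have hHs : IsSmooth (rieszTensor z) := isSmooth_rieszTensor hz
  have hbz : IsSmooth (Torus.convect b z) := hb.convect hz
  set L : (Fin 3 → Fin 3 → ℝ³) →L[ℝ] ℝ := (EuclideanSpace.proj c : ℝ³ →L[ℝ] ℝ).comp
    ((ContinuousLinearMap.proj i : (Fin 3 → ℝ³) →L[ℝ] ℝ³).comp
      (ContinuousLinearMap.proj a : (Fin 3 → Fin 3 → ℝ³) →L[ℝ] (Fin 3 → ℝ³))) with hL
  have hLapply : ∀ M : Fin 3 → Fin 3 → ℝ³, L M = M a i c := fun M => rfl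
  have h1 : Torus.convect b (rieszTensor z) x a i c = Torus.convect b (rieszHessian a i (fun y => z y c)) x := by
    rw [← hLapply, ← convect_clm_comp hHs L b x]
    have ef : (fun y => L (rieszTensor z y)) = rieszHessian a i (fun y => z y c) := by
      funext y
      rw [hLapply]
      exact (rieszHessian_apply_coord hz a i y c).symm
    rw [ef]
  have h2 : rieszTensor (Torus.convect b z) x a i c = rieszHessian a i (Torus.convect b (fun y => z y c)) x := by
    rw [show rieszTensor (Torus.convect b z) x a i c = rieszHessian a i (Torus.convect b z) x c from rfl,
      ← rieszHessian_apply_coord hbz a i x c]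
    have ef : (fun y => Torus.convect b z y c) = Torus.convect b (fun y => z y c) :=
      funext fun y => convect_apply_coord hz b y c
    rw [ef]
  rw [commutatorTensor, Pi.sub_apply, Pi.sub_apply, PiLp.sub_apply, h1, h2]

/-- The commutator tensor of smooth fields is smooth. [folklore] -/
theorem isSmooth_commutatorTensor (hb : IsSmooth b) (hz : IsSmooth z) : IsSmooth (commutatorTensor b z) :=
  (hb.convect (isSmooth_rieszTensor hz)).sub (isSmooth_rieszTensor (hb.convect hz))

/-- **The commutator `[b·∇, ℛ curl]` on Hölder spaces** (BDSV §4.4, proof of Prop. 4.3: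
"`∂ₜχᵢ[v·∇, ℛ curl](zᵢ - zᵢ₊₁)` … using Proposition D.1"): if `BDSV.commutatorCZBound` holds then
for `0 < α < 1` and every `N` there is `C < ∞` with
`‖(b·∇)ℛ(curl z) - ℛ(curl (b·∇)z)‖_{N,α} ≤ C (‖b‖_{1,α}‖z‖_{N,α} + ‖b‖_{N+1,α}‖z‖_{0,α})` for all smooth
`b, z : T³ → ℝ³` (entry-wise reduction to the scalar commutators through `BDSV.curlAssembly`).
[cite: BuckmasterEtAl2018, §4.4 (proof of Prop. 4.3) and App. D Prop. D.1] -/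
theorem commutatorCZBound.antidivergence_curl_le (h : commutatorCZBound) {α : ℝ≥0} (hα0 : 0 < α)
    (hα1 : α < 1) (N : ℕ) : ∃ C : ℝ≥0∞, C ≠ ⊤ ∧ ∀ b z : 𝕋³ → ℝ³, IsSmooth b → IsSmooth z →
      Torus.eContDiffHolderNorm N α (fun x => Torus.convect b (fun y => Torus.antidivergence (curl z) y) x -
          Torus.antidivergence (curl (Torus.convect b z)) x) ≤
        C * (Torus.eContDiffHolderNorm 1 α b * Torus.eContDiffHolderNorm N α z +
          Torus.eContDiffHolderNorm (N + 1) α b * Torus.eContDiffHolderNorm 0 α z) := by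
  obtain ⟨C, hC⟩ := h α hα0 hα1 N
  refine ⟨‖curlAssembly‖ₑ * (27 * C), ENNReal.mul_ne_top enorm_ne_top (by exact_mod_cast ENNReal.coe_ne_top),
    fun b z hb hz => ?_⟩
  set X : ℝ≥0∞ := Torus.eContDiffHolderNorm 1 α b * Torus.eContDiffHolderNorm N α z +
    Torus.eContDiffHolderNorm (N + 1) α b * Torus.eContDiffHolderNorm 0 α z with hX
  have hEs : IsSmooth (commutatorTensor b z) := isSmooth_commutatorTensor hb hz
  have hEN : IsContDiff N (commutatorTensor b z) := hEs.isContDiff (by exact_mod_cast le_top)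
  have hENa : ∀ a, IsContDiff N (fun x => commutatorTensor b z x a) := fun a =>
    (ContinuousLinearMap.proj a : (Fin 3 → Fin 3 → ℝ³) →L[ℝ] (Fin 3 → ℝ³)).contDiff.comp hEN
  have hEsai : ∀ a i, IsSmooth (fun x => commutatorTensor b z x a i) := fun a i =>
    ((ContinuousLinearMap.proj i : (Fin 3 → ℝ³) →L[ℝ] ℝ³).comp
      (ContinuousLinearMap.proj a : (Fin 3 → Fin 3 → ℝ³) →L[ℝ] (Fin 3 → ℝ³))).contDiff.comp hEs
  -- entrywise bound
  have hentry : ∀ a i c : Fin 3, Torus.eContDiffHolderNorm N α (fun x => commutatorTensor b z x a i c) ≤ C * X := by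
    intro a i c
    have e : (fun x => commutatorTensor b z x a i c) = -fun x =>
        rieszHessian a i (Torus.convect b (fun y => z y c)) x - Torus.convect b (rieszHessian a i (fun y => z y c)) x := by
      funext x
      rw [Pi.neg_apply, commutatorTensor_apply hb hz x a i c, neg_sub]
    rw [e, Torus.eContDiffHolderNorm_neg]
    calc Torus.eContDiffHolderNorm N α (fun x => rieszHessian a i (Torus.convect b (fun y => z y c)) x -
            Torus.convect b (rieszHessian a i (fun y => z y c)) x)
        ≤ C * (Torus.eContDiffHolderNorm 1 α b * Torus.eContDiffHolderNorm N α (fun y => z y c) +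
            Torus.eContDiffHolderNorm (N + 1) α b * Torus.eContDiffHolderNorm 0 α (fun y => z y c)) :=
          hC a i b (fun y => z y c) hb (hz.apply c)
      _ ≤ C * X := mul_le_mul' le_rfl (add_le_add (mul_le_mul' le_rfl (eContDiffHolderNorm_coord_le hz N α c))
          (mul_le_mul' le_rfl (eContDiffHolderNorm_coord_le hz 0 α c)))
  have hE : Torus.eContDiffHolderNorm N α (commutatorTensor b z) ≤ (27 * C) * X := by
    calc Torus.eContDiffHolderNorm N α (commutatorTensor b z)
        ≤ ∑ a, Torus.eContDiffHolderNorm N α (fun x => commutatorTensor b z x a) := eContDiffHolderNorm_pi_le_sum hEN α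
      _ ≤ ∑ a, ∑ i, Torus.eContDiffHolderNorm N α (fun x => commutatorTensor b z x a i) :=
          Finset.sum_le_sum fun a _ => eContDiffHolderNorm_pi_le_sum (hENa a) α
      _ ≤ ∑ a, ∑ i, ∑ c, Torus.eContDiffHolderNorm N α (fun x => commutatorTensor b z x a i c) :=
          Finset.sum_le_sum fun a _ => Finset.sum_le_sum fun i _ => eContDiffHolderNorm_le_sum_coord (hEsai a i) N α
      _ ≤ ∑ _a : Fin 3, ∑ _i : Fin 3, ∑ _c : Fin 3, C * X :=
          Finset.sum_le_sum fun a _ => Finset.sum_le_sum fun i _ => Finset.sum_le_sum fun c _ => hentry a i c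
      _ = 3 * (3 * (3 * (C * X))) := by
          simp only [Finset.sum_const, Finset.card_univ, Fintype.card_fin, nsmul_eq_mul, Nat.cast_ofNat]
      _ = (27 * C) * X := by ring
  have e : (fun x => Torus.convect b (fun y => Torus.antidivergence (curl z) y) x -
      Torus.antidivergence (curl (Torus.convect b z)) x) = fun x => curlAssembly (commutatorTensor b z x) :=
    funext (convect_antidivergence_curl_sub hb hz)
  rw [e]
  calc Torus.eContDiffHolderNorm N α (fun x => curlAssembly (commutatorTensor b z x))
      ≤ ‖curlAssembly‖ₑ * Torus.eContDiffHolderNorm N α (commutatorTensor b z) := Torus.eContDiffHolderNorm_clm_comp_le _ hEN α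
    _ ≤ ‖curlAssembly‖ₑ * ((27 * C) * X) := mul_le_mul' le_rfl hE
    _ = ‖curlAssembly‖ₑ * (27 * C) * X := by ring

end Commutator

end BDSV

end Literature.Analysis.FluidPDE
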